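import Summits.BirchSwinnertonDyer.BirchSwinnertonDyer.Theorems.QuadraticBranchSignedControlPlusEtaCMRankOneOfBT26
import Summits.BirchSwinnertonDyer.BirchSwinnertonDyer.Theorems.QuadraticBranchSignedControlEtaTransportCharacter
import Literature.NumberTheory.EllipticCurves.BurungaleTian2026.EtaSignedMainConjectureMuCriterionProofs
import HarnessLib

/-!
# Route `QuadraticBranchSignedControl` (rung K8, cell `bsd-potss`), node (C1⁺_η) on the CM rows of
# ANALYTIC RANK ONE — item stmt-BirchSwinnertonDyer-19114 `PlusMainConjectureBranch` (CM twists) /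
# crux 19606 `PlusEtaMainConjectureNonsurj` (stub `stub_etaMC_cm`): the `η`-NODE
# `QuadraticBranchPlusEtaMainConjectureAt V p` (all abstract models `K₀`, all plus `η`-data) on a CM
# Gss2 pair of analytic rank one FROM `BSD_p(W)`, the route's residual 19116 at the pair and named facts
# (seat `bsd-potss-k8q-c2` g4; completes `…PlusEtaCMRankOneOfBT26`)

WHAT. The companion file (p486428) proved, on a CM Gss2 pair `(W, p)` with `r_an(W) = 1`, that the
exact odd reading on a STRICT-minus dual datum of `W` over `ℚ_∞` is equivalent to
`ord_p #Ш(W)[p^∞] = ord_p #Ш_an(W)`. THIS FILE lifts that to the conclusion of 19606's registered stub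
`stub_etaMC_cm` — the print-currency node `Additive.QuadraticBranchPlusEtaMainConjectureAt V p` (every
abstract model `K₀` of `ℚ(μ_p)`, every quadratic `ηq`, every cyclotomic `κ`, `γ`, EVERY plus `η`-datum):
* §1 the `η`-twist dictionary READ BACKWARDS, at an ARBITRARY cyclotomic model `K₀`: every `η`-minus
  dual datum `D` of `V` over `K₀ℚ_∞` (Summits `EtaSignedSelmerDualData V κ K₀ ℚ_[p] ηq γ (-1)`) IS a
  strict-minus dual datum of `W` over `ℚ_∞` at the same `γ` with the SAME module, hence the same
  characteristic ideal — x1b's `strictSignedSelmerInftyEquivEta` at `(K₀, √p*, ηq)` (the data of the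
  dictionary at an abstract `K₀`: `exists_sq_eq_pStar`, k8q-c3's `eta_eq_one_iff_smul_rootInClosure`,
  `localTowerHyp_padic`, `kappa_surjOn_galRange_cyclotomic`, `coprime_index_galRange_cyclotomic`),
  re-indexing the character group; `T = γ − 1` matches because `ηq(γ) = 1` for `γ ∈ Gal(ℚ̄/K₀)`;
* §2 hence the companion's ⟺ on EVERY `η`-minus datum, and — through Burungale–Tian's own
  Thm. 7.4-for-CM (`BurungaleTian2026.thm74_etaEvenMC_iff_etaOddMC_of_cm`, from `h26` + `h22`; the
  `rfl` bridge `toLiterature` both ways) — **the plus node `QuadraticBranchPlusEtaMainConjectureAt V p`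
  on a CM pair of analytic rank one from `BSDp W p` + 19116 at the pair + `h26`, `h22`, `hPT`, `hmod`,
  reading (R2)** (`quadraticBranchPlusEtaMainConjectureAt_of_bsdp_of_bt26_of_hasCM_rankOne`), and the
  stub-shaped ∀-form on the CM rank-one rows (`etaMC_cm_rankOneRows_of_bsdp_of_bt26`) — the rank-one
  twin of g3's `etaMC_cm_rankZeroRows_of_bt26` (there `BSD_p(W)` is Burungale–Flach 2024; here it is a
  HYPOTHESIS: for a CM curve of analytic rank one with additive reduction at `p` it is NOT in print —
  cell bsd-cm's class O10).
NET for the CM rows of 19114 / 19606: r0 rows ⟸ named facts (g3); r1 rows ⟸ named facts + 19116 +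
`BSD_p(W)` (this file), and conversely the route turns (C1_η) + 19116 into `BSD_p(W)`: the `μ`-residual
of `stub_etaMC_cm` is EXACTLY `BSD_p` on the CM r1 partners, modulo the route's own residual.

HONEST FRAMING (cell `bsd-potss`; FULL-BSD rank ≤ 1 programme, tranche 1b, D-0036/D-0074): THEOREMS
ONLY — no definition (the backwards dictionary is an EXISTENCE theorem: a strict datum with the same
characteristic ideal), no new named fact, no `sorry`, axioms standard. CONDITIONAL on the displayed
hypotheses: named facts `h26` (BT26 Thm. 2.6 ∘ Kob03; NOT proved in the tree), `h22`, `hPT`, `hmod`;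
the cell's typed READING (R2) `OddBranchStrictMinusNoFiniteSubmoduleAt W p`; the route's residual
(C2_η-GZ) AT THE PAIR (item 19116, EVIDENCE item); `BSDp W p` (NOT in print for these pairs). Items
19114, 19606, 19116 and `stub_etaMC_cm` stay OPEN; nothing is booked; BSD is not proved for any curve
by this. `--supports stmt-BirchSwinnertonDyer-19606`.

References: [Kobayashi2003] Def. 2.1 (p. 5), §3 p. 5, §4 (p. 8), Thm. 7.4 (p. 13); [BurungaleTian2026]
Thm. 2.6 and Rem. 2.7 (p. 5); [GreenbergLNM1716] §1 (p. 60); [Miller2011LMS] §1, Def. 1.1.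
-/

set_option linter.dupNamespace false

noncomputable section

open scoped Classical MatrixGroups ModularForm
open CongruenceSubgroup Field Function NumberField IsDedekindDomain WeierstrassCurve
open Literature.NumberTheory.EllipticCurves Literature.NumberTheory.EllipticCurves.ModularForms
open Literature.NumberTheory.EllipticCurves.Rank1Residual Literature.NumberTheory.EllipticCurves.Rank1Residual.Typed
open Literature.NumberTheory.GaloisRepresentations Literature.NumberTheory.GaloisCohomology
open Literature.NumberTheory.EllipticCurves.IwasawaAlgebra Literature.NumberTheory.EllipticCurves.IwasawaDual
open ZpExtension Summit.BirchSwinnertonDyer.Rank1Residual.Additive Summit.BirchSwinnertonDyer.Rank1Residual.AdditivePotMult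
open Summit.BirchSwinnertonDyer.Rank1Residual.Additive.LevelBridge

namespace Summit.BirchSwinnertonDyer.BirchSwinnertonDyer.Theorems

namespace EtaCMRankOneNode

/-! ## §1 The dictionary backwards at an abstract `K₀`: an `η`-minus datum of `V` IS a strict datum of `W` -/

section Dictionary

variable (W : WeierstrassCurve ℚ) (p : ℕ) [hp : Fact p.Prime]

set_option maxHeartbeats 400000 in
/-- **`X⁻(V/K₀ℚ_∞)^η` IS `X^{−,str}(W/ℚ_∞)` — x1b's dictionary (D5) read backwards, at an ARBITRARY
`p`-th cyclotomic model `K₀`.** For the `p*`-twist `W` (`C • W^{(p*)} = V`), `p` odd, `κ` cyclotomic,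
`ηq` THE quadratic character trivial on `Gal(ℚ̄/K₀)`, `γ ∈ Gal(ℚ̄/K₀)`: every Pontryagin-dual datum `D`
of `Sel⁻(V/K₀ℚ_∞)^η` gives a dual datum of `Sel^{−,str}(W/ℚ_∞)` at the same `γ` with the SAME
`Λ`-module, so with the SAME characteristic ideal. The character group is re-indexed along
`strictSignedSelmerInftyEquivEta` at `(K₀, θ, ηq)` with `θ² = p*` in `K₀` (Gauss, `exists_sq_eq_pStar`)
and `ηq` identified as the sign character of `θ` (k8q-c3's `eta_eq_one_iff_smul_rootInClosure`); `T`
acts as `γ − 1` on both sides because `Θ_∞ ∘ conj_γ = ηq(γ)·conj_γ ∘ Θ_∞` and `ηq(γ) = 1`. Stated as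
an EXISTENCE theorem (no definition). [cite: Kobayashi2003, Def. 2.1 (p. 5), §3 p. 5, §4 p. 8 (X⁻(E/K_∞)^η)]
[cite: GreenbergLNM1716, §1 (p. 60)] -/
theorem exists_strictDual_charIdeal_eq (hp2 : p ≠ 2)
    {V : WeierstrassCurve ℚ} [V.IsElliptic] [V.IsGloballyMinimal] {C : VariableChange ℚ}
    (hCV : C • W.quadraticTwist ((-1) ^ (p / 2) * p) = V)
    {K₀ : Type} [Field K₀] [NumberField K₀] [IsCyclotomicExtension {p} ℚ K₀]
    [(galRange (K := ℚ) K₀).Normal] {ηq : absoluteGaloisGroup ℚ →* ℤˣ}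
    (hηK : ∀ σ ∈ galRange (K := ℚ) K₀, ηq σ = 1) (hη1 : ηq ≠ 1)
    {κ : ZpExtension ℚ p} (hκ : κ.IsCyclotomic) {γ : absoluteGaloisGroup ℚ}
    (hγK : γ ∈ galRange (K := ℚ) K₀) (D : EtaSignedSelmerDualData V κ K₀ ℚ_[p] ηq γ (-1)) :
    ∃ D' : StrictSignedSelmerDualData W κ ℚ_[p] γ (-1), D'.charIdeal = D.charIdeal := by
  haveI : NeZero p := ⟨hp.out.ne_zero⟩
  -- the data of the dictionary at the abstract model `K₀`
  obtain ⟨θ, hθ2⟩ := exists_sq_eq_pStar p K₀ hp2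
  have hc : θ ^ 2 = algebraMap ℚ K₀ ((-1) ^ (p / 2) * p) := by
    rw [hθ2, map_mul, map_pow, map_neg, map_one, map_natCast]
  have hθ : θ ∉ Set.range (algebraMap ℚ K₀) := by
    rintro ⟨q, hq⟩
    apply forall_sq_ne_pStar p q
    apply (algebraMap ℚ K₀).injective
    rw [map_pow, hq, hc]
  have hη : ∀ σ, ηq σ = 1 ↔ σ • rootInClosure K₀ θ = rootInClosure K₀ θ :=
    eta_eq_one_iff_smul_rootInClosure p K₀ hθ hc ηq hηK hη1
  have hD := SignedTwist.localTowerHyp_padic p κ K₀ hκ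
  have hκ₀ := kappa_surjOn_galRange_cyclotomic κ K₀
  have hcop := coprime_index_galRange_cyclotomic p K₀
  have hηγ : ((ηq γ : ℤˣ) : ℤ) = 1 := by rw [hηK γ hγK, Units.val_one]
  -- the Selmer-level isomorphism `Θ_∞ : Sel^{−,str}(W/ℚ_∞) ≃+ Sel⁻(V/K₀ℚ_∞)^η`
  set e := SignedTwist.strictSignedSelmerInftyEquivEta W K₀ hθ hc p κ hCV ηq hη ℚ_[p] hD hκ₀ hcop
    with he
  -- `Θ_∞` intertwines `conj_γ` (no sign: `ηq γ = 1`)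
  have hconj : ∀ s : strictSignedSelmerInfty W κ ℚ_[p] (-1),
      e ⟨W.conjH1 p κ.kerSubgroup γ s, conjH1_mem_strictSignedSelmerInfty W κ ℚ_[p] (-1) γ s.2⟩ =
        ⟨V.conjH1 p (towerTopSubgroup κ K₀) γ (e s : towerSignedSelmerInftyEta V κ K₀ ℚ_[p] ηq (-1)),
          D.conj_mem _ (e s).2⟩ := by
    intro s
    apply Subtype.ext
    rw [he, SignedTwist.coe_strictSignedSelmerInftyEquivEta_conjH1, hηγ, one_zsmul]
  refine ⟨{ X := D.X
            addCommGroup := D.addCommGroup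
            module := D.module
            conj_mem := fun _ hs ↦ conjH1_mem_strictSignedSelmerInfty W κ ℚ_[p] (-1) γ hs
            toDual := AddMonoidHom.mk'
              (fun x ↦ (D.toDual x).comp
                (e : strictSignedSelmerInfty W κ ℚ_[p] (-1) →+
                  towerSignedSelmerInftyEta V κ K₀ ℚ_[p] ηq (-1)))
              (fun x y ↦ by rw [map_add, AddMonoidHom.add_comp])
            bijective := ?_
            toDual_T_smul := ?_
            toDual_C_smul := ?_ }, rfl⟩
  · constructor
    · intro x y hxy
      apply D.bijective.1
      ext t
      have h := DFunLike.congr_fun hxy (e.symm t)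
      change D.toDual x (e (e.symm t)) = D.toDual y (e (e.symm t)) at h
      rwa [AddEquiv.apply_symm_apply] at h
    · intro φ
      obtain ⟨x, hx⟩ := D.bijective.2 (φ.comp
        (e.symm : towerSignedSelmerInftyEta V κ K₀ ℚ_[p] ηq (-1) →+
          strictSignedSelmerInfty W κ ℚ_[p] (-1)))
      refine ⟨x, ?_⟩
      ext s
      change D.toDual x (e s) = φ s
      rw [hx, AddMonoidHom.comp_apply, AddMonoidHom.coe_coe, AddEquiv.symm_apply_apply]
  · intro x s
    change D.toDual (PowerSeries.X • x) (e s) =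
      D.toDual x (e ⟨W.conjH1 p κ.kerSubgroup γ s, _⟩) - D.toDual x (e s)
    rw [D.toDual_T_smul x (e s), hconj s]
  · intro c x s k hk
    change D.toDual (PowerSeries.C c • x) (e s) = (PadicInt.toZModPow k c).val • D.toDual x (e s)
    exact D.toDual_C_smul c x _ k (by rw [← map_nsmul, hk, map_zero])

end Dictionary

/-! ## §2 The plus `η`-node on a CM pair of analytic rank one from `BSD_p(W)` -/

section Node

variable (W : WeierstrassCurve ℚ) [W.IsElliptic] [W.IsGloballyMinimal] (p : ℕ) [hp : Fact p.Prime]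

/-- **The companion's ⟺ on EVERY `η`-minus datum** (arbitrary model `K₀`). Frame of
`EtaCMRankOneBT26.charIdeal_eq_iff_padicValNat_card_sha_eq_of_bt26_of_hasCM_rankOne` with the strict
datum replaced by an `η`-minus datum `D` of `V` over `K₀ℚ_∞` (`γ ∈ Gal(ℚ̄/K₀)`): `Char(D.X) = (L')` ⟺
`ord_p #Ш(W)[p^∞] = ord_p s`. By §1 and the companion. CONDITIONAL on `h26`, `h22`, `hPT`, (R2),
(C2_η-GZ) at the pair; nothing booked. [cite: BurungaleTian2026, Thm. 2.6 and Rem. 2.7 (p. 5)]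
[cite: Kobayashi2003, §4 odd main [C] (p. 8), Thm. 9.3 (p. 26)] [cite: Miller2011LMS, §1 and Def. 1.1] -/
theorem etaMinus_charIdeal_eq_iff_padicValNat_card_sha_eq
    (h26 : BurungaleTian2026.thm26_etaKatoSequences_charIdeal_upToP_of_cm)
    (h22 : Kobayashi2003.thm22_etaSignedSelmerDual_finite_torsion)
    (hPT : poitouTate_selmerStructure_duality_real ℚ)
    (hR2 : OddBranchStrictMinusNoFiniteSubmoduleAt W p)
    (h2 : QuadraticBranchMinusLeadingValuationAt W p 0)
    (V : WeierstrassCurve ℚ) [V.IsElliptic] [V.IsGloballyMinimal] (C : VariableChange ℚ)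
    {N : ℕ} [NeZero N] {f : CuspForm (Gamma0 N) 2}
    (hp5 : 5 ≤ p) (hCV : C • W.quadraticTwist ((-1) ^ (p / 2) * p) = V)
    (hgood : V.HasGoodReductionAtPrime p) (hap : V.frobeniusTrace p = 0) (hCM : V.HasCM)
    (hr : W.analyticRank = 1) (hf : IsNewformOf V f) (ϖ : ℚ)
    (hϖ : if Even (p / 2) then (ϖ : ℝ) * V.realPeriodRat = plusPeriod f
      else (ϖ : ℝ) * V.imaginaryPeriodRat = minusPeriod f)
    (L : IwasawaAlgebra p) (hL : IsQuadraticBranchMinusLFunction f p ϖ L)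
    (htors : ∀ Q : (W.baseChange ℚ_[p]).toAffine.Point, p • Q = 0 → Q = 0)
    (P : W.toAffine.Point) (n : ℕ) (hP : ¬ IsOfFinAddOrder P)
    (hgen : ∀ R : W.toAffine.Point, ∃ (k : ℤ) (T : W.toAffine.Point), IsOfFinAddOrder T ∧ R = k • P + T)
    (hdiv : ∃ Q : (W.baseChange ℚ_[p]).toAffine.Point, p ^ n • Q = W.toPadicPoint p P)
    (hndiv : ∀ Q : (W.baseChange ℚ_[p]).toAffine.Point, p ^ (n + 1) • Q ≠ W.toPadicPoint p P)
    (s : ℚ) (hs : shaAn W = (s : ℂ)) (hs0 : s ≠ 0)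
    [hSha : Finite (AddCommGroup.primaryComponent W.sha p)]
    {K₀ : Type} [Field K₀] [NumberField K₀] [IsCyclotomicExtension {p} ℚ K₀]
    [(galRange (K := ℚ) K₀).Normal] {ηq : absoluteGaloisGroup ℚ →* ℤˣ}
    (hηK : ∀ σ ∈ galRange (K := ℚ) K₀, ηq σ = 1) (hη1 : ηq ≠ 1)
    {κ : ZpExtension ℚ p} {γ : absoluteGaloisGroup ℚ} (hκ : κ.IsCyclotomic)
    (hγ : κ.IsTopGenerator γ) (hγK : γ ∈ galRange (K := ℚ) K₀) (hγc : IsCyclotomicVariable p γ)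
    (D : EtaSignedSelmerDualData V κ K₀ ℚ_[p] ηq γ (-1)) (L' : IwasawaAlgebra p)
    (hLL' : L = PowerSeries.X * L') :
    D.charIdeal = Ideal.span {L'} ↔
      (padicValNat p (Nat.card (AddCommGroup.primaryComponent W.sha p)) : ℤ) = padicValRat p s := by
  obtain ⟨D', hD'⟩ := exists_strictDual_charIdeal_eq W p (by omega) hCV hηK hη1 hκ hγK D
  rw [← hD']
  exact EtaCMRankOneBT26.charIdeal_eq_iff_padicValNat_card_sha_eq_of_bt26_of_hasCM_rankOne W p h26 h22
    hPT hR2 h2 V C hp5 hCV hgood hap hCM hr hf ϖ hϖ L hL htors P n hP hgen hdiv hndiv s hs hs0 hκ hγ hγc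
    D' L' hLL'

/-- **(C1⁺_η)(V,p) — THE PLUS `η`-NODE — ON A CM Gss2 PAIR OF ANALYTIC RANK ONE FROM `BSD_p(W)`.**
`W` globally minimal, `p ≥ 5`, `C • W^{(p*)} = V` good at `p` with `a_p(V) = 0`, `V` CM, `r_an(W) = 1`.
GRANTED (hypothesis position): `h26` (BT26 Thm. 2.6 ∘ Kob03), `h22` (Kob03 Thm. 2.2 at `η`), `hPT`,
`hmod`, the reading (R2), the route's residual (C2_η-GZ) AT THE PAIR (item 19116,
`QuadraticBranchMinusLeadingValuationAt W p 0`) and `BSDp W p`: Kobayashi's even main conjecture at `η`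
VERBATIM, `Additive.QuadraticBranchPlusEtaMainConjectureAt V p` (every `K₀`, `ηq`, `f`, `ϖ`, `Lp`, `κ`,
`γ`, every plus `η`-datum). Proof: at each `(K₀, ηq, κ, γ)` the ODD statement holds on every `η`-minus
datum (previous theorem, with `BSD_p(W)`'s valuation clause, the rank-one generator and `W(ℚ_p)[p] = 0`
produced), and Burungale–Tian's own Thm. 7.4-for-CM (`thm74_etaEvenMC_iff_etaOddMC_of_cm`, from `h26` +
`h22`; `rfl` bridges to and from the Literature copy of the data) turns odd into even. CONDITIONAL;
`BSD_p(W)` for a CM curve of analytic rank one with additive reduction at `p` is NOT in print (cell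
bsd-cm class O10); nothing booked. [cite: BurungaleTian2026, Thm. 2.6 and Rem. 2.7 (p. 5)]
[cite: Kobayashi2003, §4 Even main [C] (p. 8), Thm. 7.4 (p. 13), Thm. 2.2 (p. 5)] [cite: Miller2011LMS, §1 and Def. 1.1] -/
theorem quadraticBranchPlusEtaMainConjectureAt_of_bsdp_of_bt26_of_hasCM_rankOne
    (h26 : BurungaleTian2026.thm26_etaKatoSequences_charIdeal_upToP_of_cm)
    (h22 : Kobayashi2003.thm22_etaSignedSelmerDual_finite_torsion)
    (hPT : poitouTate_selmerStructure_duality_real ℚ) (hmod : hasEntireLFunction_rat)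
    (hR2 : OddBranchStrictMinusNoFiniteSubmoduleAt W p)
    (h2 : QuadraticBranchMinusLeadingValuationAt W p 0)
    (V : WeierstrassCurve ℚ) [V.IsElliptic] [V.IsGloballyMinimal] (C : VariableChange ℚ)
    (hp5 : 5 ≤ p) (hCV : C • W.quadraticTwist ((-1) ^ (p / 2) * p) = V)
    (hgood : V.HasGoodReductionAtPrime p) (hap : V.frobeniusTrace p = 0) (hCM : V.HasCM)
    (hr : W.analyticRank = 1) (hB : BSDp W p) :
    QuadraticBranchPlusEtaMainConjectureAt V p := by
  -- `BSD_p(W)`: rank one, `Ш[p^∞]` finite, `ord_p #Ш_an = ord_p #Ш[p^∞]`; the rank-one data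
  obtain ⟨hrank, hfin, s, hs, hv⟩ := hB
  haveI := hfin
  have hs0 : s ≠ 0 := by
    rintro rfl
    exact Summit.BirchSwinnertonDyer.Rank1Residual.AdditivePotMult.shaAn_ne_zero W hmod
      (by rw [hs, Rat.cast_zero])
  have hrank1 : W.mordellWeilRank = 1 := by rw [hrank, hr]
  obtain ⟨P, n, hP, hgen, hdiv, hndiv⟩ :=
    exists_generator_and_level_of_mordellWeilRank_eq_one (p := p) W hrank1
  have htors : ∀ Q : (W.baseChange ℚ_[p]).toAffine.Point, p • Q = 0 → Q = 0 :=
    eq_zero_of_prime_smul_eq_zero_padic_of_quadraticTwist_goodSupersingular (by omega) W C V hCV hgood hap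
  intro K₀ _ _ _ _ ηq hηK hη1 N _ f hp2 hgood' hap' hf ϖ hϖ Lp hLp κ γ hκ hγ hγK hγc Dp
  obtain ⟨hfin', htor'⟩ :=
    EtaSignedSelmerDualData.finite_isTorsion_of_thm22 h22 hηK hp2 hgood hap hκ hγ hγK Dp
  refine ⟨hfin', htor', ?_⟩
  -- the ODD statement at `(K₀, ηq, κ, γ)` on every `η`-minus datum (Literature copy of the data)
  have hodd : ∀ (Lm : IwasawaAlgebra p), IsQuadraticBranchMinusLFunction f p ϖ Lm →
      ∀ (Dm : Kobayashi2003.EtaSignedSelmerDualData V κ K₀ ℚ_[p] ηq γ (-1)) (L' : IwasawaAlgebra p),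
        Lm = PowerSeries.X * L' → Dm.charIdeal = Ideal.span {L'} := by
    intro Lm hLm Dm L' hLL'
    let Ds : EtaSignedSelmerDualData V κ K₀ ℚ_[p] ηq γ (-1) :=
      ⟨Dm.X, Dm.conj_mem, Dm.toDual, Dm.bijective, Dm.toDual_T_smul, Dm.toDual_C_smul⟩
    have hDs : Ds.charIdeal = Dm.charIdeal := rfl
    rw [← hDs]
    exact (etaMinus_charIdeal_eq_iff_padicValNat_card_sha_eq W p h26 h22 hPT hR2 h2 V C hp5 hCV hgood hap
      hCM hr hf ϖ hϖ Lm hLm htors P n hP hgen hdiv hndiv s hs hs0 hηK hη1 hκ hγ hγK hγc Ds L' hLL').mpr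
      hv.symm
  -- Thm. 7.4 at `η` for CM (from BT26's package): odd ⟹ even, read on `Dp.toLiterature`
  have heven := (BurungaleTian2026.thm74_etaEvenMC_iff_etaOddMC_of_cm h26 h22 p K₀ ηq hηK hη1 V hp2
    hCM hgood hap hf ϖ hϖ κ γ hκ hγ hγK hγc).mpr hodd Lp hLp Dp.toLiterature
  rwa [EtaSignedSelmerDualData.charIdeal_toLiterature] at heven

/-- **19606's CM stub on its analytic-rank-ONE rows, from named facts + 19116 + `BSD_p`** — the rank-one
twin of g3's `etaMC_cm_rankZeroRows_of_bt26`. On the binders of `stub_etaMC_cm` (`p ≥ 5`, `V` good with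
`a_p = 0`, tower NOT onto — displayed, idle — `V` CM) with the row's rank-one condition and inputs spelled
on the additive partner (`W` globally minimal, `C • W^{(p*)} = V`, `r_an(W) = 1`, (R2) and (C2_η-GZ) at
`(W, p)`, `BSDp W p`): `QuadraticBranchPlusEtaMainConjectureAt V p`. CONDITIONAL; the stub is NOT proved
by name; nothing booked. [cite: BurungaleTian2026, Thm. 2.6 and Rem. 2.7 (p. 5)]
[cite: Kobayashi2003, §4 (p. 8), Thm. 7.4 (p. 13)] [cite: PollackRubin2004, Theorem and remark p. 448] -/
theorem etaMC_cm_rankOneRows_of_bsdp_of_bt26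
    (h26 : BurungaleTian2026.thm26_etaKatoSequences_charIdeal_upToP_of_cm)
    (h22 : Kobayashi2003.thm22_etaSignedSelmerDual_finite_torsion)
    (hPT : poitouTate_selmerStructure_duality_real ℚ) (hmod : hasEntireLFunction_rat) :
    ∀ (V : WeierstrassCurve ℚ) [V.IsElliptic] [V.IsGloballyMinimal] (p : ℕ) [Fact p.Prime],
      5 ≤ p → V.HasGoodReductionAtPrime p → V.frobeniusTrace p = 0 →
      ¬ (∀ m : ℕ, V.HasSurjectiveModNGaloisRep (p ^ m : ℕ)) → V.HasCM →
      ∀ (W : WeierstrassCurve ℚ) [W.IsElliptic] [W.IsGloballyMinimal] (C : VariableChange ℚ),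
        C • W.quadraticTwist ((-1) ^ (p / 2) * p) = V → W.analyticRank = 1 →
        OddBranchStrictMinusNoFiniteSubmoduleAt W p → QuadraticBranchMinusLeadingValuationAt W p 0 →
        BSDp W p → QuadraticBranchPlusEtaMainConjectureAt V p := by
  intro V _ _ p _ hp5 hgood hap _ hCM W _ _ C hCV hr hR2 h2 hB
  exact quadraticBranchPlusEtaMainConjectureAt_of_bsdp_of_bt26_of_hasCM_rankOne W p h26 h22 hPT hmod hR2
    h2 V C hp5 hCV hgood hap hCM hr hB

end Node

end EtaCMRankOneNode

end Summit.BirchSwinnertonDyer.BirchSwinnertonDyer.Theorems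

end
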